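import Summits.AnomalousDissipation.AnomalousDissipation.Theorems.EulerLimitEulerlimitThesisV2KrTimeModesCauchy
import Summits.AnomalousDissipation.AnomalousDissipation.Theorems.EulerLimitEulerlimitThesisV2KrMollifyError
import Summits.AnomalousDissipation.AnomalousDissipation.Theorems.EulerLimitEulerlimitThesisV2KrSpaceTimeCauchy
import Summits.AnomalousDissipation.AnomalousDissipation.Theorems.EulerLimitEulerlimitThesisV2KrLimitOfCauchy
import Summits.AnomalousDissipation.AnomalousDissipation.Theorems.EulerLimitEulerlimitThesisV2KrPeriodicExtension
import HarnessLib

/-!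
# Stub `stub_kolmogorovRieszPeriodicSlab` of line `tight`
(crux `EulerLimit.EulerlimitThesisV2`, stmt-AnomalousDissipation-0511)

**Kolmogorov–M. Riesz–Fréchet on the periodic slab, sufficiency.**  A family of fields
`v j : ℝ → 𝕋³ → ℝ³`, jointly smooth on `ℝ × 𝕋³`, bounded in `L³((0,τ) × 𝕋³)` and
`L³`-equicontinuous under space–time translations uniformly in `j`, has a subsequence converging in
`L³((0,τ) × 𝕋³)` (junk-free nested `lintegral`) to a `τ`-periodic field `w` whose space–time lift
is a.e.-strongly measurable on `(0,τ) × ℝ³`.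

The proof is the assembly of the STUB-PLAN (`Cruxes/EulerlimitThesisV2/STUB-PLAN-stub_kolmogorovRieszPeriodicSlab.md`):
De Rosa–Isett's §6.1 Aubin–Lions–Simon discharge
(`Literature.Barriers.AnomalousDissipation.DeRosaIsett2024_s61_compactness_holds`) with its two
PDE/Besov inputs swapped for the two AXIS SLICES of the Kolmogorov–Riesz modulus — only the slices
`h = 0` (time) and `s = 0` (space) of the joint modulus and the `L³` bound are used; the periodicity
of the `v j` is not needed:

1. `stub_krTimeModesCauchy` (H3, fed by H1–H2 `stub_krCellCauchy`): a subsequence `φ₁` with every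
   spatial Fourier mode Cauchy in `L³(0,τ)`, from the TIME modulus;
2. `stub_krMollifyError` (H4): the space–time mollification error is at most the SPACE modulus;
3. `stub_krSpaceTimeCauchy` (H5): Cauchy in `L³((0,τ) × 𝕋³)` along `φ₁`;
4. `stub_krLimitOfCauchy` (H6): the strong limit `V` along a further subsequence `ψ`;
5. `stub_krPeriodicExtension` (H7): periodise the representative; `φ := φ₁ ∘ ψ`.

The file ends with the REGISTERED stub `stub_kolmogorovRieszPeriodicSlab`, signature verbatim
(local notations `𝕋³`, `E³` as in `Lines/tight.lean`).
-/

noncomputable section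

-- D-0017: single-problem summit ⇒ the duplicated namespace segment is by design.
set_option linter.dupNamespace false

open MeasureTheory Set Function Filter UnitAddTorus
open scoped ENNReal Topology Convolution

namespace Summit.AnomalousDissipation.AnomalousDissipation.Theorems.EulerLimitKR

open Literature.Analysis.FunctionSpaces Literature.Analysis.FunctionSpaces.Torus

/-- The physical flat unit torus `𝕋³` (local notation). -/
local notation "𝕋³" => UnitAddTorus (Fin 3)
/-- Velocity values (local notation). -/
local notation "E³" => EuclideanSpace ℝ (Fin 3)

/-- **Registered stub `stub_kolmogorovRieszPeriodicSlab` of line `tight` — Kolmogorov–Riesz on the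
periodic slab (sufficiency).**  A family of jointly smooth, `τ`-periodic-in-time fields
`v j : ℝ → 𝕋³ → E³`, bounded in `L³((0,τ) × 𝕋³)` and `L³`-equicontinuous under space–time
translations uniformly in `j`, has a subsequence converging in `L³((0,τ) × 𝕋³)` to a `τ`-periodic
field `w` whose space–time lift is a.e.-strongly measurable on `(0,τ) × ℝ³`.  Assembly: Step 0 the
bound `B := ofReal M` and the two AXIS SLICES of the modulus in `ℝ≥0∞` form; Step 1
`stub_krTimeModesCauchy` → `φ₁`; Step 2 `stub_krMollifyError` → uniform mollification error along
`φ₁`; Step 3 `stub_krSpaceTimeCauchy` → Cauchy; Step 4 `stub_krLimitOfCauchy` → `ψ, V`; Step 5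
`stub_krPeriodicExtension` → `w`; `φ := φ₁ ∘ ψ` (Kolmogorov–M. Riesz–Fréchet / Simon 1987, §8,
Thm. 5, sufficiency, on the compact group `(ℝ/τℤ) × 𝕋³`). [cite: Simon1986, §8 Thm. 5] -/
theorem stub_kolmogorovRieszPeriodicSlab :
    ∀ (τ M : ℝ) (v : ℕ → ℝ → 𝕋³ → E³), 0 < τ →
      (∀ j, Literature.Analysis.FunctionSpaces.Torus.IsSmoothSpaceTimeOn Set.univ (v j)) →
      (∀ j, Function.Periodic (v j) τ) →
      (∀ j, ∫⁻ t in Set.Ioo 0 τ, ∫⁻ x, ‖v j t x‖ₑ ^ 3 ≤ ENNReal.ofReal M) →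
      (∀ ε : ℝ, 0 < ε → ∃ δ : ℝ, 0 < δ ∧ ∀ (j : ℕ) (s : ℝ) (h : 𝕋³), |s| ≤ δ → ‖h‖ ≤ δ →
          ∫⁻ t in Set.Ioo 0 τ, ∫⁻ x, ‖v j (t + s) (x + h) - v j t x‖ₑ ^ 3 ≤ ENNReal.ofReal ε) →
      ∃ (w : ℝ → 𝕋³ → E³) (φ : ℕ → ℕ), StrictMono φ ∧ Function.Periodic w τ ∧
        MeasureTheory.AEStronglyMeasurable (Literature.Analysis.FunctionSpaces.Torus.stLift w)
          (MeasureTheory.volume.restrict (Set.Ioo 0 τ ×ˢ Set.univ)) ∧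
        Filter.Tendsto (fun j => ∫⁻ t in Set.Ioo 0 τ, ∫⁻ x, ‖v (φ j) t x - w t x‖ₑ ^ 3)
          Filter.atTop (nhds 0) := by
  intro τ M v hτ hsm _hper hM hKR
  -- Step 0: the bound and the two AXIS SLICES of the modulus, in `ℝ≥0∞` form
  have hB : ENNReal.ofReal M ≠ ⊤ := ENNReal.ofReal_ne_top
  have hsm' : ∀ j, IsSmoothSpaceTimeOn (Ioo 0 τ) (v j) := fun j => (hsm j).mono (subset_univ _)
  have hmodT : ∀ Λ : ℝ≥0∞, 0 < Λ → ∃ δ : ℝ, 0 < δ ∧ ∀ (j : ℕ) (σ : ℝ), |σ| ≤ δ →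
      ∫⁻ t in Ioo 0 τ, ∫⁻ x, ‖v j (t + σ) x - v j t x‖ₑ ^ 3 ≤ Λ := by
    intro Λ hΛ
    rcases eq_or_ne Λ ⊤ with hΛt | hΛt
    · exact ⟨1, one_pos, fun j σ _ => hΛt ▸ le_top⟩
    obtain ⟨δ, hδ, hδ'⟩ := hKR Λ.toReal (ENNReal.toReal_pos hΛ.ne' hΛt)
    refine ⟨δ, hδ, fun j σ hσ => ?_⟩
    have h := hδ' j σ 0 hσ (by simpa using hδ.le)
    simpa only [add_zero, ENNReal.ofReal_toReal hΛt] using h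
  have hmodX : ∀ Λ : ℝ≥0∞, 0 < Λ → ∃ δ : ℝ, 0 < δ ∧ ∀ (j : ℕ) (y : 𝕋³), ‖y‖ ≤ δ →
      ∫⁻ t in Ioo 0 τ, ∫⁻ x, ‖v j t (x - y) - v j t x‖ₑ ^ 3 ≤ Λ := by
    intro Λ hΛ
    rcases eq_or_ne Λ ⊤ with hΛt | hΛt
    · exact ⟨1, one_pos, fun j y _ => hΛt ▸ le_top⟩
    obtain ⟨δ, hδ, hδ'⟩ := hKR Λ.toReal (ENNReal.toReal_pos hΛ.ne' hΛt)
    refine ⟨δ, hδ, fun j y hy => ?_⟩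
    have h := hδ' j 0 (-y) (by simpa using hδ.le) (by rwa [norm_neg])
    simpa only [add_zero, ← sub_eq_add_neg, ENNReal.ofReal_toReal hΛt] using h
  -- Step 1 (H3, fed by H1/H2): a subsequence `φ₁` with Cauchy Fourier modes in `L³(0,τ)`
  obtain ⟨φ₁, hφ₁, hmodes⟩ := stub_krTimeModesCauchy τ _ v hτ hB hsm hM hmodT
  -- Step 2 (H4): uniform mollification error from the SPACE modulus
  have hmoll : ∀ ρ : ℝ≥0∞, 0 < ρ → ∃ ε : ℝ, 0 < ε ∧ ε ≤ 1 / 4 ∧ ∀ n,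
      ∫⁻ t in Ioo 0 τ, ∫⁻ x, ‖(kernel ε ⋆ v (φ₁ n) t) x - v (φ₁ n) t x‖ₑ ^ 3 ≤ ρ := by
    intro ρ hρ
    obtain ⟨δ, hδ, hδ'⟩ := hmodX ρ hρ
    refine ⟨min δ (1 / 4), lt_min hδ (by norm_num), min_le_right _ _, fun n => ?_⟩
    exact stub_krMollifyError τ (v (φ₁ n)) _ ρ hτ (hsm' (φ₁ n)) (lt_min hδ (by norm_num))
      (min_le_right _ _) (fun y hy => hδ' (φ₁ n) y (hy.trans (min_le_left _ _)))
  -- Step 3 (H5): Cauchy in `L³((0,τ) × 𝕋³)` along `φ₁`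
  have hcau : ∀ η : ℝ≥0∞, 0 < η → ∃ N : ℕ, ∀ n m : ℕ, N ≤ n → N ≤ m →
      ∫⁻ t in Ioo 0 τ, ∫⁻ x, ‖v (φ₁ n) t x - v (φ₁ m) t x‖ₑ ^ 3 ≤ η := fun η hη =>
    stub_krSpaceTimeCauchy τ _ (fun n => v (φ₁ n)) hτ hB (fun n => hsm' (φ₁ n))
      (fun n => hM (φ₁ n)) hmoll hmodes η hη
  -- Step 4 (H6): the strong limit `V` along a further subsequence `ψ`
  obtain ⟨ψ, V, hψ, hVm, hlim⟩ := stub_krLimitOfCauchy τ _ (fun n => v (φ₁ n))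
    (fun n => (hsm' (φ₁ n)).aestronglyMeasurable_uncurry_prod) hB (fun n => hM (φ₁ n)) hcau
  -- Step 5 (H7): periodise the representative
  obtain ⟨w, hwper, hwV, hwm⟩ := stub_krPeriodicExtension τ V hτ hVm
  refine ⟨w, φ₁ ∘ ψ, hφ₁.comp hψ, hwper, hwm, ?_⟩
  have heq : ∀ n, ∫⁻ t in Ioo 0 τ, ∫⁻ x, ‖v ((φ₁ ∘ ψ) n) t x - w t x‖ₑ ^ 3 =
      ∫⁻ t in Ioo 0 τ, ∫⁻ x, ‖v (φ₁ (ψ n)) t x - V t x‖ₑ ^ 3 := fun n =>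
    setLIntegral_congr_fun measurableSet_Ioo fun t ht => by simp only [Function.comp_apply, hwV t ht]
  simp_rw [heq]
  exact hlim

end Summit.AnomalousDissipation.AnomalousDissipation.Theorems.EulerLimitKR

end
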